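import Summits.NavierStokesRegularity.FunctionalMining.TopEigProductionRate
import Summits.NavierStokesRegularity.FunctionalMining.TopEigHeatStable
import HarnessLib

/-!
# FunctionalMining — time reversal: the LEFT production rate of the `λ₁` moment, the differentiability criterion, and the heat sieve in Danskin form

Search for candidate a priori estimates; no regularity claim. Cell `pub-nsfunc`, prove seat
(gen 21). Companion to `TopEigProductionRate.lean` (the exact RIGHT derivative
`d⁺/ds Φ_q(u(s)) = ∫ q λ₁^{q−1} μ(S; Ṡ)` along jointly smooth divergence-free families):

* `TopEig.isSmoothSpaceTimeOn_reverse`, `TopEig.timeDerivWithin_strainFlat_reverse` — time reversal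
  `s ↦ u(−s)` preserves joint smoothness and negates the one-sided time derivative of the strain;
* **`TopEig.hasDerivWithinAt_topEigMoment_spaceTime_left`** — the LEFT derivative at `t ∈ (a, b]` is
  `−∫ q λ₁^{q−1} μ(S; −Ṡ) = ∫ q λ₁^{q−1} min{eᵀṠe : e ∈ E(S)}`;
* **`TopEig.differentiableAt_topEigMoment_spaceTime_iff`** — at an interior time, `s ↦ Φ_q(u(s))` is
  differentiable iff the two one-sided Danskin integrals agree (pointwise `max − min ≥ 0` of `eᵀṠe`
  over the top eigen-set, `TopEig.dirTopEig_add_dirTopEig_neg_nonneg`): the `DifferentiableWithinAt`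
  clause of the typed `IsRateBudget` rows for the `λ₁` cores, made explicit;
* `TopEig.integral_danskinDensity_laplacian_nonpos` — the tree's heat sieve
  `0 ≤ heatDissipation (∫(λ₁⁺)^q) v` on `T³` read through Danskin: `∫ q λ₁^{q−1} μ(S; ΔS) ≤ 0`;
* `TopEig.hasDerivWithinAt_negBotEigMoment_spaceTime` — the `−λ₃` core (`u ↦ −u`).

[ours; folklore calculus]
-/

noncomputable section

open MeasureTheory Set Filter Topology
open scoped ContDiff

namespace Summit.NavierStokesRegularity.FunctionalMining

open Literature.Analysis.FunctionSpaces Literature.Analysis.FluidPDE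

namespace TopEig

variable {d : Type*} [Fintype d] [DecidableEq d] [Nonempty d]

/-! ## 1. Time reversal and the left derivative -/

omit [DecidableEq d] [Nonempty d] in
/-- Time reversal preserves joint smoothness: `s ↦ u(−s)` is jointly smooth on `[−b, −a] × T^d`.
[folklore] -/
theorem isSmoothSpaceTimeOn_reverse {a b : ℝ} {u : ℝ → UnitAddTorus d → EuclideanSpace ℝ d}
    (hu : Torus.IsSmoothSpaceTimeOn (Icc a b) u) :
    Torus.IsSmoothSpaceTimeOn (Icc (-b) (-a)) (fun s => u (-s)) := by
  unfold Torus.IsSmoothSpaceTimeOn at hu ⊢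
  have hmap : ContDiff ℝ ∞
      (fun z : ℝ × EuclideanSpace ℝ d => ((-z.1, z.2) : ℝ × EuclideanSpace ℝ d)) :=
    (contDiff_neg.comp contDiff_fst).prodMk contDiff_snd
  have hmaps : MapsTo (fun z : ℝ × EuclideanSpace ℝ d => ((-z.1, z.2) : ℝ × EuclideanSpace ℝ d))
      (Icc (-b) (-a) ×ˢ univ) (Icc a b ×ˢ univ) := by
    intro z hz
    refine mk_mem_prod ?_ (mem_univ _)
    have h1 := (mem_prod.1 hz).1
    simp only [mem_Icc] at h1 ⊢
    constructor <;> linarith [h1.1, h1.2]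
  have h := hu.comp hmap.contDiffOn hmaps
  have hfun : Torus.stLift (fun s => u (-s)) =
      Torus.stLift u ∘ fun z : ℝ × EuclideanSpace ℝ d => ((-z.1, z.2) : ℝ × EuclideanSpace ℝ d) := by
    funext z; rfl
  rw [hfun]
  exact h

omit [Nonempty d] in
/-- The one-sided time derivative of the reversed strain at `−t` is minus that of the strain at `t`
(`derivWithin` under `s ↦ −s`). [folklore] -/
theorem timeDerivWithin_strainFlat_reverse {a b : ℝ} (u : ℝ → UnitAddTorus d → EuclideanSpace ℝ d)
    (t : ℝ) (x : UnitAddTorus d) :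
    Torus.timeDerivWithin (Icc (-b) (-a)) (fun s y => StrainL4.strainFlat (u (-s)) y) (-t) x =
      -Torus.timeDerivWithin (Icc a b) (fun s y => StrainL4.strainFlat (u s) y) t x := by
  unfold Torus.timeDerivWithin
  have hset : -(Icc (-b) (-a)) = Icc a b := by
    ext s
    simp only [Set.mem_neg, mem_Icc]
    constructor <;> intro h <;> constructor <;> linarith [h.1, h.2]
  have h := derivWithin_comp_neg (f := fun τ => StrainL4.strainFlat (u τ) x) (s := Icc (-b) (-a))
    (x := -t)
  rw [hset, neg_neg] at h
  exact h

/-- **The LEFT derivative of the `λ₁` moment** along a jointly smooth divergence-free family: for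
`t ∈ (a, b]`, `s ↦ Φ_q(u(s))` has left derivative `−∫ q λ₁^{q−1} μ(S(u(t)); −Ṡ(t)) dx =
∫ q λ₁^{q−1} min{eᵀṠe : e ∈ E(S)} dx` at `t` (the right-derivative theorem for the time-reversed
family `s ↦ u(−s)`). [ours] -/
theorem hasDerivWithinAt_topEigMoment_spaceTime_left {a b : ℝ} (hab : a < b)
    {u : ℝ → UnitAddTorus d → EuclideanSpace ℝ d} (hu : Torus.IsSmoothSpaceTimeOn (Icc a b) u)
    (hdiv : ∀ s ∈ Icc a b, Torus.IsDivFree (u s)) {q : ℝ} (hq : 1 ≤ q) {t : ℝ} (ht : t ∈ Ioc a b) :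
    HasDerivWithinAt (fun s => torusTopEigMoment q (u s))
      (-∫ x, q * torusStrainTopEig (u t) x ^ (q - 1) *
        dirTopEig (StrainL4.strainFlat (u t) x)
          (-Torus.timeDerivWithin (Icc a b) (fun s y => StrainL4.strainFlat (u s) y) t x))
      (Set.Iio t) t := by
  have hab' : -b < -a := by linarith
  have hur : Torus.IsSmoothSpaceTimeOn (Icc (-b) (-a)) (fun s => u (-s)) :=
    isSmoothSpaceTimeOn_reverse hu
  have hdivr : ∀ s ∈ Icc (-b) (-a), Torus.IsDivFree ((fun s => u (-s)) s) := fun s hs =>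
    hdiv (-s) ⟨by linarith [hs.2], by linarith [hs.1]⟩
  have htr : -t ∈ Ico (-b) (-a) := ⟨by linarith [ht.2], by linarith [ht.1]⟩
  have hR := hasDerivWithinAt_topEigMoment_spaceTime hab' hur hdivr hq htr
  -- compose with `s ↦ −s`
  have hneg : HasDerivWithinAt (fun s : ℝ => -s) (-1) (Set.Iio t) t := hasDerivWithinAt_neg t (Set.Iio t)
  have hmaps : Set.MapsTo (fun s : ℝ => -s) (Set.Iio t) (Set.Ioi (-t)) := fun s hs => by
    simp only [Set.mem_Iio, Set.mem_Ioi] at hs ⊢; linarith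
  have hcomp := hR.scomp_of_eq t (h := fun s : ℝ => -s) hneg hmaps rfl
  have hfun : ((fun s => torusTopEigMoment q ((fun s => u (-s)) s)) ∘ fun s : ℝ => -s) =
      fun s => torusTopEigMoment q (u s) := by
    funext s; simp only [Function.comp_apply, neg_neg]
  rw [hfun] at hcomp
  refine hcomp.congr_deriv ?_
  rw [smul_eq_mul, neg_one_mul]
  congr 1
  refine integral_congr_ae (ae_of_all _ fun x => ?_)
  show q * torusStrainTopEig (u (- -t)) x ^ (q - 1) *
      dirTopEig (StrainL4.strainFlat (u (- -t)) x)
        (Torus.timeDerivWithin (Icc (-b) (-a)) (fun s y => StrainL4.strainFlat (u (-s)) y) (-t) x) =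
    q * torusStrainTopEig (u t) x ^ (q - 1) * dirTopEig (StrainL4.strainFlat (u t) x)
      (-Torus.timeDerivWithin (Icc a b) (fun s y => StrainL4.strainFlat (u s) y) t x)
  rw [neg_neg, timeDerivWithin_strainFlat_reverse]

/-- `μ(A; M) + μ(A; −M) ≥ 0` (`max ≥ min` of `eᵀMe` over the top eigen-set): the right production
density dominates the left one pointwise. [folklore] -/
theorem dirTopEig_add_dirTopEig_neg_nonneg (A M : EuclideanSpace ℝ (d × d)) :
    0 ≤ dirTopEig A M + dirTopEig A (-M) := by
  have h := dirTopEig_add_le A M (-M)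
  rw [add_neg_cancel, ← zero_smul ℝ A, dirTopEig_smul_self, zero_mul] at h
  exact h

/-- **When is `s ↦ Φ_q(u(s))` differentiable?** At an interior time `t ∈ (a, b)` of a jointly
smooth divergence-free family, `s ↦ Φ_q(u(s))` is differentiable at `t` iff the right and left
Danskin integrals agree: `∫ qλ₁^{q−1} μ(S; Ṡ) = −∫ qλ₁^{q−1} μ(S; −Ṡ)`, i.e. iff
`max − min` of `eᵀṠe` over the top eigen-set `E(S(t, x))` integrates to zero against `qλ₁^{q−1}`
(each term is `≥ 0`, `dirTopEig_add_dirTopEig_neg_nonneg`). This is the clause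
`DifferentiableWithinAt` of the typed `IsRateBudget` rows for the `λ₁` cores, made explicit. [ours] -/
theorem differentiableAt_topEigMoment_spaceTime_iff {a b : ℝ} (hab : a < b)
    {u : ℝ → UnitAddTorus d → EuclideanSpace ℝ d} (hu : Torus.IsSmoothSpaceTimeOn (Icc a b) u)
    (hdiv : ∀ s ∈ Icc a b, Torus.IsDivFree (u s)) {q : ℝ} (hq : 1 ≤ q) {t : ℝ} (ht : t ∈ Ioo a b) :
    DifferentiableAt ℝ (fun s => torusTopEigMoment q (u s)) t ↔
      (∫ x, q * torusStrainTopEig (u t) x ^ (q - 1) *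
          dirTopEig (StrainL4.strainFlat (u t) x)
            (Torus.timeDerivWithin (Icc a b) (fun s y => StrainL4.strainFlat (u s) y) t x)) =
        -∫ x, q * torusStrainTopEig (u t) x ^ (q - 1) *
          dirTopEig (StrainL4.strainFlat (u t) x)
            (-Torus.timeDerivWithin (Icc a b) (fun s y => StrainL4.strainFlat (u s) y) t x) := by
  have hR := hasDerivWithinAt_topEigMoment_spaceTime hab hu hdiv hq ⟨ht.1.le, ht.2⟩
  have hL := hasDerivWithinAt_topEigMoment_spaceTime_left hab hu hdiv hq ⟨ht.1, ht.2.le⟩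
  constructor
  · intro hd
    have h1 := hd.hasDerivAt.hasDerivWithinAt (s := Set.Ioi t)
    have h2 := hd.hasDerivAt.hasDerivWithinAt (s := Set.Iio t)
    have e1 := hR.derivWithin (uniqueDiffWithinAt_Ioi t)
    have e2 := hL.derivWithin (uniqueDiffWithinAt_Iio t)
    rw [h1.derivWithin (uniqueDiffWithinAt_Ioi t)] at e1
    rw [h2.derivWithin (uniqueDiffWithinAt_Iio t)] at e2
    rw [← e1, ← e2]
  · intro heq
    rw [← heq] at hL
    have h := hL.union hR
    rw [Set.Iio_union_Ioi, Set.compl_eq_univ_sdiff, hasDerivWithinAt_sdiff_singleton,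
      hasDerivWithinAt_univ] at h
    exact h.differentiableAt

/-! ## 2. The heat sieve in Danskin form -/

/-- **The heat sieve in Danskin form.** On `T³`, for every smooth divergence-free `v` and real
`q ≥ 1`: `∫ q λ₁^{q−1} μ(S; ΔS) dx ≤ 0` — the tree's heat sieve `0 ≤ heatDissipation (∫(λ₁⁺)^q) v`
(`heatDissipation_nonneg_of_admissible`, via the mollified weight) read through Danskin's formula.
A global inequality: the integrand has no sign pointwise. [ours] -/
theorem integral_danskinDensity_laplacian_nonpos {q : ℝ} (hq : 1 ≤ q)
    {v : UnitAddTorus (Fin 3) → EuclideanSpace ℝ (Fin 3)} (hv : Torus.IsSmooth v)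
    (hdiv : Torus.IsDivFree v) :
    ∫ x, q * torusStrainTopEig v x ^ (q - 1) *
        dirTopEig (StrainL4.strainFlat v x) (StrainL4.strainFlat (Torus.laplacian v) x) ≤ 0 := by
  have h1 := heatDissipation_topEigMoment_eq_integral hq hv hdiv
  have h2 : 0 ≤ heatDissipation (torusTopEigMoment q) v :=
    heatDissipation_nonneg_of_admissible hq convexOn_lam lipschitzWith_lam
      (fun _ hv hdiv x => lam_strainFlat_nonneg hv hdiv x)
      (fun _ hv hdiv => torusTopEigMoment_eq hv hdiv q) hv hdiv
  linarith

/-! ## 3. The `−λ₃` core (`u ↦ −u`) -/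

omit [DecidableEq d] [Nonempty d] in
/-- `s ↦ −u(s)` is jointly smooth when `u` is. [folklore] -/
theorem isSmoothSpaceTimeOn_neg {a b : ℝ} {u : ℝ → UnitAddTorus d → EuclideanSpace ℝ d}
    (hu : Torus.IsSmoothSpaceTimeOn (Icc a b) u) :
    Torus.IsSmoothSpaceTimeOn (Icc a b) (fun s => -u s) := by
  unfold Torus.IsSmoothSpaceTimeOn at hu ⊢
  have hfun : Torus.stLift (fun s => -u s) = fun z => -Torus.stLift u z := by funext z; rfl
  rw [hfun]
  exact hu.neg

omit [Nonempty d] in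
/-- The one-sided time derivative of the strain of `−u` is minus that of `u`. [folklore] -/
theorem timeDerivWithin_strainFlat_neg {a b : ℝ} (u : ℝ → UnitAddTorus d → EuclideanSpace ℝ d)
    (t : ℝ) (x : UnitAddTorus d) :
    Torus.timeDerivWithin (Icc a b) (fun s y => StrainL4.strainFlat (-u s) y) t x =
      -Torus.timeDerivWithin (Icc a b) (fun s y => StrainL4.strainFlat (u s) y) t x := by
  unfold Torus.timeDerivWithin
  have hfun : (fun τ => StrainL4.strainFlat (-u τ) x) = -fun τ => StrainL4.strainFlat (u τ) x := by
    funext τ; simp only [Pi.neg_apply, strainFlat_neg]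
  rw [hfun, derivWithin.neg]

/-- **Exact one-sided production rate of the `−λ₃` moment** along a jointly smooth divergence-free
family (`∫((−λ₃)⁺)^q` of `u` is `∫(λ₁⁺)^q` of `−u`): for `t ∈ [a, b)`,
`d⁺/ds|ₜ ∫((−λ₃)⁺)^q(S(u(s))) = ∫ q (−λ₃)^{q−1} μ(−S; −Ṡ) dx`. [ours] -/
theorem hasDerivWithinAt_negBotEigMoment_spaceTime {a b : ℝ} (hab : a < b)
    {u : ℝ → UnitAddTorus d → EuclideanSpace ℝ d} (hu : Torus.IsSmoothSpaceTimeOn (Icc a b) u)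
    (hdiv : ∀ s ∈ Icc a b, Torus.IsDivFree (u s)) {q : ℝ} (hq : 1 ≤ q) {t : ℝ} (ht : t ∈ Ico a b) :
    HasDerivWithinAt (fun s => torusNegBotEigMoment q (u s))
      (∫ x, q * (-torusStrainBotEig (u t) x) ^ (q - 1) *
        dirTopEig (-StrainL4.strainFlat (u t) x)
          (-Torus.timeDerivWithin (Icc a b) (fun s y => StrainL4.strainFlat (u s) y) t x))
      (Set.Ioi t) t := by
  have hun : Torus.IsSmoothSpaceTimeOn (Icc a b) (fun s => -u s) := isSmoothSpaceTimeOn_neg hu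
  have hdivn : ∀ s ∈ Icc a b, Torus.IsDivFree ((fun s => -u s) s) := fun s hs =>
    (torus_isDivFree_neg_iff (u s)).2 (hdiv s hs)
  have h := hasDerivWithinAt_topEigMoment_spaceTime hab hun hdivn hq ht
  have hfun : (fun s => torusTopEigMoment q ((fun s => -u s) s)) =
      fun s => torusNegBotEigMoment q (u s) := by
    funext s; exact torusTopEigMoment_neg q (u s)
  rw [hfun] at h
  refine h.congr_deriv (integral_congr_ae (ae_of_all _ fun x => ?_))
  show q * torusStrainTopEig (-u t) x ^ (q - 1) * dirTopEig (StrainL4.strainFlat (-u t) x)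
      (Torus.timeDerivWithin (Icc a b) (fun s y => StrainL4.strainFlat (-u s) y) t x) = _
  rw [torusStrainTopEig_neg, strainFlat_neg, timeDerivWithin_strainFlat_neg]

end TopEig

end Summit.NavierStokesRegularity.FunctionalMining

end
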